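import Mathlib

/-!
# Weighted `ℓ¹` sizes from radius-type bounds and polynomial level growth

Stub `stub_summable_of_levelGrowth` (S17) for the crux `HilbertIntegralOverconvergentIsCongruence`
(line Sketch-ideate-r1-k1).  The line's algebraization engine needs the weighted `ℓ¹` sizes
`Σ_x ‖a_x‖ t^{wt x}` of multivariable `q`-expansions to be finite for every `0 ≤ t < 1`, given
radius-type bounds `‖a_x‖ s^{wt x} ≤ C_s` for every `0 < s < 1` and level sets `{wt = n}` of
polynomial size `#{wt = n} ≤ A (n+1)^d`.

Proof: for `t < 1` pick `s := (t+1)/2 ∈ (t, 1)`; then `‖a_x‖ t^{wt x} = (‖a_x‖ s^{wt x}) (t/s)^{wt x}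
≤ C' r^{wt x}` with `r := t/s ∈ [0, 1)` and `C' := max C_s 0`, so it suffices that `x ↦ r^{wt x}` is
summable.  Regrouping along the (finite) fibres of `wt` (`Equiv.sigmaFiberEquiv`,
`summable_sigma_of_nonneg`) this reduces to the summability of `Σ_n #{wt = n} r^n ≤ Σ_n A (n+1)^d r^n`,
which follows from `summable_pow_mul_geometric_of_norm_lt_one` and `(n+1)^d ≤ 2^d n^d + 1`.
-/

set_option linter.dupNamespace false

noncomputable section

namespace Summit.Langlands.Langlands.Theorems.HilbertIntegralOverconvergentIsCongruence

/-- Elementary polynomial comparison `(n+1)^d ≤ 2^d n^d + 1` for natural numbers `n`, `d`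
(for `n = 0` the right-hand `1` suffices, for `n ≥ 1` use `n + 1 ≤ 2n`). -/
theorem lvlSum_succ_pow_le (n dd : ℕ) : ((n : ℝ) + 1) ^ dd ≤ 2 ^ dd * (n : ℝ) ^ dd + 1 := by
  rcases Nat.eq_zero_or_pos n with rfl | hn
  · simp only [Nat.cast_zero, zero_add, one_pow]
    exact le_add_of_nonneg_left (by positivity)
  · have h1 : (n : ℝ) + 1 ≤ 2 * n := by
      have : (1 : ℝ) ≤ n := Nat.one_le_cast.mpr hn
      linarith
    calc ((n : ℝ) + 1) ^ dd ≤ (2 * (n : ℝ)) ^ dd := pow_le_pow_left₀ (by positivity) h1 dd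
      _ = 2 ^ dd * (n : ℝ) ^ dd := mul_pow 2 (n : ℝ) dd
      _ ≤ 2 ^ dd * (n : ℝ) ^ dd + 1 := le_add_of_nonneg_right zero_le_one

/-- The polynomially weighted geometric series `Σ_n (n+1)^d r^n` converges for `0 ≤ r < 1`
(comparison with `2^d Σ n^d r^n + Σ r^n`, Mathlib `summable_pow_mul_geometric_of_norm_lt_one`,
`summable_geometric_of_lt_one`). -/
theorem lvlSum_summable_succ_pow_mul_geometric (dd : ℕ) {r : ℝ} (hr0 : 0 ≤ r) (hr1 : r < 1) :
    Summable (fun n : ℕ ↦ ((n : ℝ) + 1) ^ dd * r ^ n) := by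
  have hr : ‖r‖ < 1 := by rwa [Real.norm_of_nonneg hr0]
  have h1 : Summable (fun n : ℕ ↦ (n : ℝ) ^ dd * r ^ n) :=
    summable_pow_mul_geometric_of_norm_lt_one dd hr
  have h2 : Summable (fun n : ℕ ↦ r ^ n) := summable_geometric_of_lt_one hr0 hr1
  refine Summable.of_nonneg_of_le (fun n ↦ by positivity) (fun n ↦ ?_) ((h1.mul_left (2 ^ dd)).add h2)
  calc ((n : ℝ) + 1) ^ dd * r ^ n ≤ (2 ^ dd * (n : ℝ) ^ dd + 1) * r ^ n :=
        mul_le_mul_of_nonneg_right (lvlSum_succ_pow_le n dd) (pow_nonneg hr0 n)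
    _ = 2 ^ dd * ((n : ℝ) ^ dd * r ^ n) + r ^ n := by ring

/-- Summability of `x ↦ r^{wt x}` over a type `X` graded by `wt : X → ℕ` with finite level sets of
polynomial size `#{wt = n} ≤ A (n+1)^d`, for `0 ≤ r < 1`: regroup along the fibres of `wt`
(`Equiv.sigmaFiberEquiv`, `summable_sigma_of_nonneg`, `tsum_const`) and compare the resulting series
`Σ_n #{wt = n} r^n` with `Σ_n A (n+1)^d r^n`. -/
theorem lvlSum_summable_pow_weight {X : Type*} (wt : X → ℕ) (dd : ℕ) (Aℓ : ℝ)
    (hlevel : ∀ n : ℕ, {x : X | wt x = n}.Finite ∧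
      (({x : X | wt x = n}.ncard : ℕ) : ℝ) ≤ Aℓ * ((n : ℝ) + 1) ^ dd)
    {r : ℝ} (hr0 : 0 ≤ r) (hr1 : r < 1) :
    Summable (fun x : X ↦ r ^ wt x) := by
  refine (Equiv.summable_iff (Equiv.sigmaFiberEquiv wt)).mp ?_
  have heq : ((fun x : X ↦ r ^ wt x) ∘ (Equiv.sigmaFiberEquiv wt)) =
      fun p : Σ n : ℕ, {x : X // wt x = n} ↦ r ^ p.1 := by
    funext p
    simp only [Function.comp_apply, Equiv.sigmaFiberEquiv_apply, p.2.2]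
  rw [heq, summable_sigma_of_nonneg (fun p ↦ by positivity)]
  constructor
  · intro n
    haveI : Finite {x : X // wt x = n} := (hlevel n).1.to_subtype
    exact Summable.of_finite
  · simp only [tsum_const, nsmul_eq_mul]
    have hbd : ∀ n : ℕ, (Nat.card {x : X // wt x = n} : ℝ) * r ^ n ≤
        Aℓ * (((n : ℝ) + 1) ^ dd * r ^ n) := by
      intro n
      rw [← mul_assoc]
      refine mul_le_mul_of_nonneg_right ?_ (pow_nonneg hr0 n)
      have h := (hlevel n).2
      rwa [← Nat.card_coe_set_eq] at h
    exact Summable.of_nonneg_of_le (fun n ↦ by positivity) hbd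
      ((lvlSum_summable_succ_pow_mul_geometric dd hr0 hr1).mul_left Aℓ)

/-- **stub S17 — `stub_summable_of_levelGrowth` (S/M; weighted sizes from radius-type bounds).**  For a weight
`wt : X → ℕ` with finite level sets of polynomial size `#{wt = n} ≤ A (n+1)^d` and coefficients `a : X → ℂ` with
`‖a_x‖ s^{wt x} ≤ C_s` for every `0 < s < 1`: `Σ_x ‖a_x‖ t^{wt x} < ∞` for every `0 ≤ t < 1` (compare with
`C_s (t/s)^{wt x}` for `s ∈ (t, 1)` and sum over the level sets: `Σ_n A (n+1)^d (t/s)^n < ∞`; Mathlib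
`Equiv.sigmaFiberEquiv`, `summable_sigma_of_nonneg`, `summable_pow_mul_geometric_of_norm_lt_one`). [folklore] -/
theorem stub_summable_of_levelGrowth {X : Type*} (wt : X → ℕ) (dd : ℕ) (Aℓ : ℝ)
    (hlevel : ∀ n : ℕ, {x : X | wt x = n}.Finite ∧ (({x : X | wt x = n}.ncard : ℕ) : ℝ) ≤ Aℓ * ((n : ℝ) + 1) ^ dd)
    (a : X → ℂ) (hbound : ∀ s : ℝ, 0 < s → s < 1 → ∃ C : ℝ, ∀ x, ‖a x‖ * s ^ wt x ≤ C)
    (t : ℝ) (ht0 : 0 ≤ t) (ht1 : t < 1) :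
    Summable (fun x : X ↦ ‖a x‖ * t ^ wt x) := by
  -- an intermediate radius `t < s < 1`
  obtain ⟨s, hs0, hts, hs1⟩ : ∃ s : ℝ, 0 < s ∧ t < s ∧ s < 1 :=
    ⟨(t + 1) / 2, by positivity, by linarith, by linarith⟩
  obtain ⟨C, hC⟩ := hbound s hs0 hs1
  -- the ratio `r = t / s ∈ [0, 1)`
  have hr0 : 0 ≤ t / s := div_nonneg ht0 hs0.le
  have hr1 : t / s < 1 := (div_lt_one hs0).mpr hts
  -- pointwise comparison `‖a x‖ t^{wt x} ≤ C' (t/s)^{wt x}` with `C' = max C 0`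
  have hpt : ∀ x, ‖a x‖ * t ^ wt x ≤ max C 0 * (t / s) ^ wt x := by
    intro x
    have hsplit : t ^ wt x = s ^ wt x * (t / s) ^ wt x := by
      rw [← mul_pow, mul_div_cancel₀ t hs0.ne']
    rw [hsplit, ← mul_assoc]
    exact mul_le_mul_of_nonneg_right ((hC x).trans (le_max_left _ _)) (pow_nonneg hr0 _)
  exact Summable.of_nonneg_of_le (fun x ↦ by positivity) hpt
    ((lvlSum_summable_pow_weight wt dd Aℓ hlevel hr0 hr1).mul_left (max C 0))

end Summit.Langlands.Langlands.Theorems.HilbertIntegralOverconvergentIsCongruence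

end
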